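import Summits.RiemannHypothesis.RiemannHypothesis.Theorems.TiltedLandingLaw421R3Lens1CoverageRS2
import Summits.RiemannHypothesis.RiemannHypothesis.Theorems.TiltedLandingLaw421R3RateSkeleton
import Summits.RiemannHypothesis.RiemannHypothesis.Theses.EarlyAppointments

/-! # trkD_v10q (half) — UPGRADE DRAFT-1 (director-rh g23 (CA492)/(CA500)/(CA501)) — skeleton for `TiltedLandingLaw421R` at `halfPurse` with BOTH halves exposed in their
prover-facing currency (every refinement below is a kernel EQUIVALENCE of the v8q stubs, by proved doors / `rateLawsHalfQ_iff_canonical`; the registry tracks the TEXT a prover or adversary must beat):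
SUCC — ONE residual in LINEAGE currency `RhW08.Lens1Coverage.RegHungCut10S` (lens-1 module RS2-v1 0791b932 on RS-v1 af697aca on S «hung boxes» 0a8482f7):
`RegHungCut10S := binders + exclusions of RegHung9S VERBATIM → (∃ i ≤ j, ¬ ColumnCuttable f x₀ R Hs i) → ∃ u, StTrkDQ … (j+1) u` — a successor is owed ONLY by a configuration outside the five proved
regimes, with no hung signed box at level j, AND with an UNCUTTABLE column couple at some level i ≤ j (the complement of the PROVED central-lineage door `RhW08.Lens1SignCut.succ_of_columnCuttable_upTo`;
= adversary program A3′ «column-lineage surfing + terminal steal», crit-1 HANDS-30 / CUT 6). Monotone by name: `regHungCut10S_of_regHung9S`, `regHung9S_of_regHungCut10S`, `regRes8S_of_regHungCut10S`.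
RATE — the purse-½ rate laws split at the CANONICAL budgets (lens-2 module (3j) RateSkeletonDefs-v2 ee26c734, kernel `RhW08.BurgersRateG3.rateLawsHalfQ_iff_canonical : RateLawsHalfQ ↔ F1 ∧ F2c ∧ Cc ∧ Ac`):
F1 `FarEnergyLawCQ (4/5)` (far-chain energy law; lens-2ʼs 7-law A-typed chain `RateSkeleton-v2.lean` 293aa8c7 sits behind it as a LINE FILE, never the registry), F2c `EnergyRiseLawQ riseSupQ`, Cc `ConsLawQ consSupQ`
(per-frame boundedness at the least budgets), Ac = ★A `ApproachAllowanceQ (approachBudgetHalfQ riseSupQ consSupQ)` (the ONE analytic inequality of the non-far half; no mechanism of record — W-09).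
INTERFACE: `…/Theorems/TiltedLandingLaw421R3Lens1CoverageRS2.lean` (RS2-v1: `def RegHungCut10S`, `TiltedLandingLaw421R_of_regHungCut10S : RegHungCut10S → RhW08.RateSplit.RateLawsHalfQ → crux`) and
`…/Theorems/TiltedLandingLaw421R3RateSkeleton.lean` (Defs-v2: `riseSupQ`, `consSupQ`, `rateLawsHalfQ_of_canonical (hF1) (hF2) (hC) (hA) : RhW08.RateSplit.RateLawsHalfQ`).
USE RULE (CA501): registers as `Lines/trkD_v10q.lean` only after S (3i), RS (3i′), RS2 (3i″) and RateSkeleton (3j) are ACCEPTED in the tree AND desk PRE-CERT ×1 + critic PRE-PLANT ×2 + crit-1 shred/costume word on the five stubs;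
fallback if RS2 or (3j) stalls: v9q DRAFT-1 90a594a0. -/

namespace Summit.RiemannHypothesis.RiemannHypothesis.Cruxes.TiltedLandingLaw421R.TrkDV10Q

set_option linter.dupNamespace false

/-- OPEN SUCC residual stub (cell-free, SUCCESSOR conclusion, LINEAGE currency): `RhW08.Lens1Coverage.RegHungCut10S`. -/
theorem stub_regHungCut10S : RhW08.Lens1Coverage.RegHungCut10S := by
  sorry

/-- OPEN RATE stub F1 (lens-2): the far-chain energy law `RhW08.SealSwapQ.FarEnergyLawCQ (4/5)`. -/
theorem stub_farEnergyLawCQ : RhW08.SealSwapQ.FarEnergyLawCQ (4 / 5) := by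
  sorry

/-- OPEN RATE stub F2c: energy-rise law at the canonical budget `RhW08.BurgersRateG3.riseSupQ` (per-frame boundedness of the charged rise sums). -/
theorem stub_energyRiseC : RhW08.SealSwapQ.EnergyRiseLawQ RhW08.BurgersRateG3.riseSupQ := by
  sorry

/-- OPEN RATE stub Cc: conservative-cost law at the canonical budget `RhW08.BurgersRateG3.consSupQ`. -/
theorem stub_consC : RhW08.SealSwapQ.ConsLawQ RhW08.BurgersRateG3.consSupQ := by
  sorry

/-- OPEN RATE stub Ac = ★A: the approach allowance at the canonical budgets (the one analytic inequality of the non-far half). -/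
theorem stub_approachC :
    RhW08.SealSwapQ.ApproachAllowanceQ (RhW08.RateSplit.approachBudgetHalfQ RhW08.BurgersRateG3.riseSupQ RhW08.BurgersRateG3.consSupQ) := by
  sorry

/-- The crux BY NAME from the five stubs (`TiltedLandingLaw421R_of_regHungCut10S` ∘ `rateLawsHalfQ_of_canonical`). -/
theorem TiltedLandingLaw421R_of : Summit.RiemannHypothesis.RiemannHypothesis.Theses.EarlyAppointments.TiltedLandingLaw421R :=
  RhW08.Lens1Coverage.TiltedLandingLaw421R_of_regHungCut10S stub_regHungCut10S
    (RhW08.BurgersRateG3.rateLawsHalfQ_of_canonical stub_farEnergyLawCQ stub_energyRiseC stub_consC stub_approachC)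

end Summit.RiemannHypothesis.RiemannHypothesis.Cruxes.TiltedLandingLaw421R.TrkDV10Q
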